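import Mathlib
import Literature.Computability.AlgebraicComplexity.GroupTheoreticMatMul
import Literature.Computability.AlgebraicComplexity.STPPPuncturedAxesPair
import Summits.MatrixMultiplication.MatrixMultiplication.Theorems.AbelianSTPPCensusCrossPacking

/-!
# The Cohn–Kleinberg–Szegedy–Umans punctured-axes pair in `(ℤ/n)³` is nearly non-extendable (every `n ≥ 3`)

Cell mm-stpp (seat theory g8), an infinite-family STRUCTURAL theorem obtained from the cross packing
(`STPPCrossPacking.sum_card_mul_add_card_cross_le`, this seat): let `P₀, P₁, P₂ ⊂ H = (ℤ/n)³` be the punctured coordinate axes and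
let an `IsSTPP` family contain, at two indices `j ≠ k`, the CKSU pair `(P₀, P₁, P₂)`, `(P₁, P₂, P₀)` (which IS an STPP family for every
`n`, `Literature…isSTPP_puncturedAxes_pair`, CKSU 2005 Prop. 5.2).  The cross sumset of the pair,
`(A_k − B_j) + (C_j − C_k) = (P₁ − P₁) + (P₂ − P₀)`, contains every `(x, y, z)` with `x ≠ 0`, `z ≠ 0` (`n ≥ 3`), i.e. `n(n−1)²` of the
`n³` elements, and all difference sets `A_t − B_t` (in particular the pair's own, `(n−1)²` elements each) avoid it.  Hence
**every further member `u` of the family has `|A_u||B_u| ≤ 3n − 2`** (`card_mul_le`), and by the rotated cross packings also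
`|B_u||C_u| ≤ 3n − 2`, `|C_u||A_u| ≤ 3n − 2` (`card_mul_le_BC`, `card_mul_le_CA`); in particular for `n ≥ 5` the pair admits NO
third member of the uniform shape `(n−1, n−1, n−1)` (`no_uniform_third_member`; `(n−1)² > 3n − 2`), and more generally no third
member of volume `> (3n−2)^{3/2}`.  For `n = 5` this is the structural content of the cell's R-5 Q-v enumeration result «the
Prop 5.2 pair has partners but no completion to (4,4,4)³» (mm-stpp-eng-1 j257800 / pencil §4.2; REF [149]/[150]) — here for all `n`,
in one line from the cross packing, kernel-checked.  Appendix (rev. 2): through ONE frame triple `(P₀,P₁,P₂)` the tree's U14⁺ gives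
`Σ_{t≠l} |A_t||B_t| ≤ n(2n−1)` (`sum_card_mul_le_of_frame`; the arithmetic remark of `GroupTheoreticSTPPCThesisPackingSumset.lean`).
WHAT THIS IS NOT: no statement about (4,4,4)³ families NOT containing the CKSU pair (eng-1's structure lemma §4.1 covers those at
`n = 5` by enumeration); no `ω` statement; no census row.
-/

-- single-conjunct summit: the mandated namespace repeats `MatrixMultiplication`.
set_option linter.dupNamespace false

namespace Summit.MatrixMultiplication.MatrixMultiplication.Theorems

namespace STPPCKSUPair

open Finset Literature.Computability.AlgebraicComplexity
open scoped Pointwise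

variable {n : ℕ}

/-! ## Arithmetic in `ℤ/n`, `n ≥ 3` -/

/-- `1 ≠ 0` in `ℤ/n` for `n ≥ 3`. [bookkeeping] -/
theorem one_ne_zero_of_three_le (hn : 3 ≤ n) : (1 : ZMod n) ≠ 0 := by
  haveI : Fact (1 < n) := ⟨by omega⟩
  exact one_ne_zero

/-- `2 ≠ 0` in `ℤ/n` for `n ≥ 3`. [bookkeeping] -/
theorem two_ne_zero_of_three_le (hn : 3 ≤ n) : (2 : ZMod n) ≠ 0 := by
  intro h
  have h' : ((2 : ℕ) : ZMod n) = 0 := by exact_mod_cast h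
  rw [ZMod.natCast_eq_zero_iff] at h'
  have := Nat.le_of_dvd (by norm_num) h'
  omega

/-- In `ℤ/n`, `n ≥ 3`, every element is a difference of two NON-ZERO elements. [bookkeeping] -/
theorem exists_sub_of_ne_zero (hn : 3 ≤ n) (y : ZMod n) : ∃ y₁ y₂ : ZMod n, y₁ ≠ 0 ∧ y₂ ≠ 0 ∧ y₁ - y₂ = y := by
  by_cases hy : y + 1 = 0
  · refine ⟨y + 2, 2, ?_, two_ne_zero_of_three_le hn, by ring⟩
    have : y + 2 = (y + 1) + 1 := by ring
    rw [this, hy, zero_add]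
    exact one_ne_zero_of_three_le hn
  · exact ⟨y + 1, 1, hy, one_ne_zero_of_three_le hn, by ring⟩

/-! ## The punctured axes and the three cross sumsets of the CKSU pair -/

variable {P₀ P₁ P₂ : Finset (ZMod n × ZMod n × ZMod n)}

section Card

variable [NeZero n]

/-- The non-zero residues. [bookkeeping] -/
theorem card_filter_ne_zero : (univ.filter fun x : ZMod n => x ≠ 0).card = n - 1 := by
  rw [filter_ne', card_erase_of_mem (mem_univ _), card_univ, ZMod.card]

/-- `|P₀| = n − 1`. [bookkeeping] -/
theorem card_P₀ (hP₀ : ∀ v, v ∈ P₀ ↔ v.1 ≠ 0 ∧ v.2.1 = 0 ∧ v.2.2 = 0) : P₀.card = n - 1 := by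
  have e : P₀ = (univ.filter fun x : ZMod n => x ≠ 0).image fun x => (x, (0 : ZMod n), (0 : ZMod n)) := by
    ext v
    rw [hP₀, mem_image]
    constructor
    · rintro ⟨h1, h2, h3⟩
      exact ⟨v.1, mem_filter.mpr ⟨mem_univ _, h1⟩, Prod.ext rfl (Prod.ext h2.symm h3.symm)⟩
    · rintro ⟨x, hx, rfl⟩
      exact ⟨(mem_filter.mp hx).2, rfl, rfl⟩
  rw [e, card_image_of_injective _ fun x y hxy => (Prod.mk.inj hxy).1, card_filter_ne_zero]

/-- `|P₁| = n − 1`. [bookkeeping] -/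
theorem card_P₁ (hP₁ : ∀ v, v ∈ P₁ ↔ v.2.1 ≠ 0 ∧ v.1 = 0 ∧ v.2.2 = 0) : P₁.card = n - 1 := by
  have e : P₁ = (univ.filter fun x : ZMod n => x ≠ 0).image fun x => ((0 : ZMod n), x, (0 : ZMod n)) := by
    ext v
    rw [hP₁, mem_image]
    constructor
    · rintro ⟨h1, h2, h3⟩
      exact ⟨v.2.1, mem_filter.mpr ⟨mem_univ _, h1⟩, Prod.ext h2.symm (Prod.ext rfl h3.symm)⟩
    · rintro ⟨x, hx, rfl⟩
      exact ⟨(mem_filter.mp hx).2, rfl, rfl⟩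
  rw [e, card_image_of_injective _ fun x y hxy => (Prod.mk.inj (Prod.mk.inj hxy).2).1, card_filter_ne_zero]

/-- `|P₂| = n − 1`. [bookkeeping] -/
theorem card_P₂ (hP₂ : ∀ v, v ∈ P₂ ↔ v.2.2 ≠ 0 ∧ v.1 = 0 ∧ v.2.1 = 0) : P₂.card = n - 1 := by
  have e : P₂ = (univ.filter fun x : ZMod n => x ≠ 0).image fun x => ((0 : ZMod n), (0 : ZMod n), x) := by
    ext v
    rw [hP₂, mem_image]
    constructor
    · rintro ⟨h1, h2, h3⟩
      exact ⟨v.2.2, mem_filter.mpr ⟨mem_univ _, h1⟩, Prod.ext h2.symm (Prod.ext h3.symm rfl)⟩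
    · rintro ⟨x, hx, rfl⟩
      exact ⟨(mem_filter.mp hx).2, rfl, rfl⟩
  rw [e, card_image_of_injective _ fun x y hxy => (Prod.mk.inj (Prod.mk.inj hxy).2).2, card_filter_ne_zero]

end Card

/-- The `D`-cross sumset of the pair: `(P₁ − P₁) + (P₂ − P₀) ⊇ {(x,y,z) : x ≠ 0, z ≠ 0}` (`n ≥ 3`). [original] -/
theorem filter_subset_crossD (hn : 3 ≤ n) [NeZero n]
    (hP₀ : ∀ v, v ∈ P₀ ↔ v.1 ≠ 0 ∧ v.2.1 = 0 ∧ v.2.2 = 0)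
    (hP₁ : ∀ v, v ∈ P₁ ↔ v.2.1 ≠ 0 ∧ v.1 = 0 ∧ v.2.2 = 0)
    (hP₂ : ∀ v, v ∈ P₂ ↔ v.2.2 ≠ 0 ∧ v.1 = 0 ∧ v.2.1 = 0) :
    (univ.filter fun x : ZMod n => x ≠ 0) ×ˢ ((univ : Finset (ZMod n)) ×ˢ (univ.filter fun x : ZMod n => x ≠ 0))
      ⊆ (P₁ - P₁) + (P₂ - P₀) := by
  intro v hv
  rw [mem_product, mem_product, mem_filter, mem_filter] at hv
  obtain ⟨⟨-, hx⟩, -, -, hz⟩ := hv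
  obtain ⟨y₁, y₂, hy₁, hy₂, hy⟩ := exists_sub_of_ne_zero hn v.2.1
  rw [mem_add]
  refine ⟨((0 : ZMod n), y₁ - y₂, (0 : ZMod n)), ?_, (v.1, (0 : ZMod n), v.2.2), ?_, ?_⟩
  · rw [mem_sub]
    exact ⟨(0, y₁, 0), (hP₁ _).mpr ⟨hy₁, rfl, rfl⟩, (0, y₂, 0), (hP₁ _).mpr ⟨hy₂, rfl, rfl⟩,
      Prod.ext (by simp) (Prod.ext rfl (by simp))⟩
  · rw [mem_sub]
    refine ⟨(0, 0, v.2.2), (hP₂ _).mpr ⟨hz, rfl, rfl⟩, (-v.1, 0, 0), (hP₀ _).mpr ⟨neg_ne_zero.mpr hx, rfl, rfl⟩, ?_⟩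
    exact Prod.ext (by simp) (Prod.ext (by simp) (by simp))
  · exact Prod.ext (by simp) (Prod.ext (by simpa using hy) (by simp))

/-- The `E`-cross sumset of the pair: `(P₂ − P₂) + (P₀ − P₁) ⊇ {(x,y,z) : x ≠ 0, y ≠ 0}` (`n ≥ 3`). [original] -/
theorem filter_subset_crossE (hn : 3 ≤ n) [NeZero n]
    (hP₀ : ∀ v, v ∈ P₀ ↔ v.1 ≠ 0 ∧ v.2.1 = 0 ∧ v.2.2 = 0)
    (hP₁ : ∀ v, v ∈ P₁ ↔ v.2.1 ≠ 0 ∧ v.1 = 0 ∧ v.2.2 = 0)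
    (hP₂ : ∀ v, v ∈ P₂ ↔ v.2.2 ≠ 0 ∧ v.1 = 0 ∧ v.2.1 = 0) :
    (univ.filter fun x : ZMod n => x ≠ 0) ×ˢ ((univ.filter fun x : ZMod n => x ≠ 0) ×ˢ (univ : Finset (ZMod n)))
      ⊆ (P₂ - P₂) + (P₀ - P₁) := by
  intro v hv
  rw [mem_product, mem_product, mem_filter, mem_filter] at hv
  obtain ⟨⟨-, hx⟩, ⟨-, hy⟩, -⟩ := hv
  obtain ⟨z₁, z₂, hz₁, hz₂, hz⟩ := exists_sub_of_ne_zero hn v.2.2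
  rw [mem_add]
  refine ⟨((0 : ZMod n), (0 : ZMod n), z₁ - z₂), ?_, (v.1, v.2.1, (0 : ZMod n)), ?_, ?_⟩
  · rw [mem_sub]
    exact ⟨(0, 0, z₁), (hP₂ _).mpr ⟨hz₁, rfl, rfl⟩, (0, 0, z₂), (hP₂ _).mpr ⟨hz₂, rfl, rfl⟩,
      Prod.ext (by simp) (Prod.ext (by simp) rfl)⟩
  · rw [mem_sub]
    refine ⟨(v.1, 0, 0), (hP₀ _).mpr ⟨hx, rfl, rfl⟩, (0, -v.2.1, 0), (hP₁ _).mpr ⟨neg_ne_zero.mpr hy, rfl, rfl⟩, ?_⟩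
    exact Prod.ext (by simp) (Prod.ext (by simp) (by simp))
  · exact Prod.ext (by simp) (Prod.ext (by simp) (by simpa using hz))

/-- The `F`-cross sumset of the pair: `(P₀ − P₀) + (P₁ − P₂) ⊇ {(x,y,z) : y ≠ 0, z ≠ 0}` (`n ≥ 3`). [original] -/
theorem filter_subset_crossF (hn : 3 ≤ n) [NeZero n]
    (hP₀ : ∀ v, v ∈ P₀ ↔ v.1 ≠ 0 ∧ v.2.1 = 0 ∧ v.2.2 = 0)
    (hP₁ : ∀ v, v ∈ P₁ ↔ v.2.1 ≠ 0 ∧ v.1 = 0 ∧ v.2.2 = 0)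
    (hP₂ : ∀ v, v ∈ P₂ ↔ v.2.2 ≠ 0 ∧ v.1 = 0 ∧ v.2.1 = 0) :
    (univ : Finset (ZMod n)) ×ˢ ((univ.filter fun x : ZMod n => x ≠ 0) ×ˢ (univ.filter fun x : ZMod n => x ≠ 0))
      ⊆ (P₀ - P₀) + (P₁ - P₂) := by
  intro v hv
  rw [mem_product, mem_product, mem_filter, mem_filter] at hv
  obtain ⟨-, ⟨-, hy⟩, -, hz⟩ := hv
  obtain ⟨x₁, x₂, hx₁, hx₂, hx⟩ := exists_sub_of_ne_zero hn v.1
  rw [mem_add]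
  refine ⟨(x₁ - x₂, (0 : ZMod n), (0 : ZMod n)), ?_, ((0 : ZMod n), v.2.1, v.2.2), ?_, ?_⟩
  · rw [mem_sub]
    exact ⟨(x₁, 0, 0), (hP₀ _).mpr ⟨hx₁, rfl, rfl⟩, (x₂, 0, 0), (hP₀ _).mpr ⟨hx₂, rfl, rfl⟩,
      Prod.ext rfl (Prod.ext (by simp) (by simp))⟩
  · rw [mem_sub]
    refine ⟨(0, v.2.1, 0), (hP₁ _).mpr ⟨hy, rfl, rfl⟩, (0, 0, -v.2.2), (hP₂ _).mpr ⟨neg_ne_zero.mpr hz, rfl, rfl⟩, ?_⟩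
    exact Prod.ext (by simp) (Prod.ext (by simp) (by simp))
  · exact Prod.ext (by simpa using hx) (Prod.ext (by simp) (by simp))

/-! ## Third members through the CKSU pair are small -/

variable [NeZero n] {N : ℕ} {A B C : Fin N → Finset (ZMod n × ZMod n × ZMod n)}

/-- The sum over all members dominates the three members `j, k, u` (pairwise distinct). [bookkeeping] -/
theorem three_le_sum (f : Fin N → ℕ) {j k u : Fin N} (hjk : j ≠ k) (huj : u ≠ j) (huk : u ≠ k) :
    f j + f k + f u ≤ ∑ t, f t := by
  classical
  have hsub : ({j, k, u} : Finset (Fin N)) ⊆ univ := subset_univ _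
  have h := sum_le_sum_of_subset_of_nonneg hsub (fun t _ _ => Nat.zero_le (f t))
  rw [sum_insert (by simp [hjk, Ne.symm huj]), sum_pair (Ne.symm huk)] at h
  omega

/-- The arithmetic of the conclusion: from `2(n−1)² + ab + n(n−1)² ≤ n³` infer `ab ≤ 3n − 2`. [bookkeeping] -/
theorem arith (hn : 1 ≤ n) {x : ℕ}
    (h : (n - 1) * (n - 1) + (n - 1) * (n - 1) + x + (n - 1) * (n * (n - 1)) ≤ n * (n * n)) : x + 2 ≤ 3 * n := by
  obtain ⟨m, rfl⟩ : ∃ m, n = m + 1 := ⟨n - 1, by omega⟩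
  simp only [Nat.add_sub_cancel] at h
  nlinarith [h]

/-- **Third members through the CKSU pair, `D`-form.** In `H = (ℤ/n)³`, `n ≥ 3`, let an `IsSTPP` family (all `C_t` non-empty) contain
the CKSU punctured-axes pair `(P₀,P₁,P₂)` at index `j` and `(P₁,P₂,P₀)` at index `k ≠ j`.  Then every other member `u` has
`|A_u||B_u| ≤ 3n − 2`. [original] -/
theorem card_mul_le (hn : 3 ≤ n)
    (hP₀ : ∀ v, v ∈ P₀ ↔ v.1 ≠ 0 ∧ v.2.1 = 0 ∧ v.2.2 = 0)
    (hP₁ : ∀ v, v ∈ P₁ ↔ v.2.1 ≠ 0 ∧ v.1 = 0 ∧ v.2.2 = 0)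
    (hP₂ : ∀ v, v ∈ P₂ ↔ v.2.2 ≠ 0 ∧ v.1 = 0 ∧ v.2.1 = 0)
    (h : IsSTPP A B C) (hC : ∀ t, (C t).Nonempty) {j k u : Fin N} (hjk : j ≠ k) (huj : u ≠ j) (huk : u ≠ k)
    (hAj : A j = P₀) (hBj : B j = P₁) (hCj : C j = P₂) (hAk : A k = P₁) (hBk : B k = P₂) (hCk : C k = P₀) :
    (A u).card * (B u).card + 2 ≤ 3 * n := by
  classical
  have hx := STPPCrossPacking.sum_card_mul_add_card_cross_le h hC hjk
  rw [hAk, hBj, hCj, hCk] at hx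
  have hQ := card_le_card (filter_subset_crossD hn hP₀ hP₁ hP₂)
  rw [card_product, card_product, card_univ, ZMod.card, card_filter_ne_zero] at hQ
  have h3 := three_le_sum (fun t => (A t).card * (B t).card) hjk huj huk
  simp only [hAj, hBj, hAk, hBk, card_P₀ hP₀, card_P₁ hP₁, card_P₂ hP₂] at h3
  have hG : Fintype.card (ZMod n × ZMod n × ZMod n) = n * (n * n) := by
    simp only [Fintype.card_prod, ZMod.card]
  rw [hG] at hx
  exact arith (by omega) (by omega)

/-- **`E`-form:** with all `A_t` non-empty, every other member `u` has `|B_u||C_u| ≤ 3n − 2`. [original] -/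
theorem card_mul_le_BC (hn : 3 ≤ n)
    (hP₀ : ∀ v, v ∈ P₀ ↔ v.1 ≠ 0 ∧ v.2.1 = 0 ∧ v.2.2 = 0)
    (hP₁ : ∀ v, v ∈ P₁ ↔ v.2.1 ≠ 0 ∧ v.1 = 0 ∧ v.2.2 = 0)
    (hP₂ : ∀ v, v ∈ P₂ ↔ v.2.2 ≠ 0 ∧ v.1 = 0 ∧ v.2.1 = 0)
    (h : IsSTPP A B C) (hA : ∀ t, (A t).Nonempty) {j k u : Fin N} (hjk : j ≠ k) (huj : u ≠ j) (huk : u ≠ k)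
    (hAj : A j = P₀) (hBj : B j = P₁) (hCj : C j = P₂) (hAk : A k = P₁) (hBk : B k = P₂) (hCk : C k = P₀) :
    (B u).card * (C u).card + 2 ≤ 3 * n := by
  classical
  have hx := STPPCrossPacking.sum_card_mul_add_card_cross_le_BC h hA hjk
  rw [hBk, hCj, hAj, hAk] at hx
  have hQ := card_le_card (filter_subset_crossE hn hP₀ hP₁ hP₂)
  rw [card_product, card_product, card_univ, ZMod.card, card_filter_ne_zero] at hQ
  have h3 := three_le_sum (fun t => (B t).card * (C t).card) hjk huj huk
  simp only [hBj, hCj, hBk, hCk, card_P₀ hP₀, card_P₁ hP₁, card_P₂ hP₂] at h3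
  have hG : Fintype.card (ZMod n × ZMod n × ZMod n) = n * (n * n) := by
    simp only [Fintype.card_prod, ZMod.card]
  rw [hG] at hx
  refine arith (by omega) (x := (B u).card * (C u).card) ?_
  nlinarith [hx, hQ, h3]

/-- **`F`-form:** with all `B_t` non-empty, every other member `u` has `|C_u||A_u| ≤ 3n − 2`. [original] -/
theorem card_mul_le_CA (hn : 3 ≤ n)
    (hP₀ : ∀ v, v ∈ P₀ ↔ v.1 ≠ 0 ∧ v.2.1 = 0 ∧ v.2.2 = 0)
    (hP₁ : ∀ v, v ∈ P₁ ↔ v.2.1 ≠ 0 ∧ v.1 = 0 ∧ v.2.2 = 0)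
    (hP₂ : ∀ v, v ∈ P₂ ↔ v.2.2 ≠ 0 ∧ v.1 = 0 ∧ v.2.1 = 0)
    (h : IsSTPP A B C) (hB : ∀ t, (B t).Nonempty) {j k u : Fin N} (hjk : j ≠ k) (huj : u ≠ j) (huk : u ≠ k)
    (hAj : A j = P₀) (hBj : B j = P₁) (hCj : C j = P₂) (hAk : A k = P₁) (hBk : B k = P₂) (hCk : C k = P₀) :
    (C u).card * (A u).card + 2 ≤ 3 * n := by
  classical
  have hx := STPPCrossPacking.sum_card_mul_add_card_cross_le_CA h hB hjk
  rw [hCk, hAj, hBj, hBk] at hx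
  have hQ := card_le_card (filter_subset_crossF hn hP₀ hP₁ hP₂)
  rw [card_product, card_product, card_univ, ZMod.card, card_filter_ne_zero] at hQ
  have h3 := three_le_sum (fun t => (C t).card * (A t).card) hjk huj huk
  simp only [hCj, hAj, hCk, hAk, card_P₀ hP₀, card_P₁ hP₁, card_P₂ hP₂] at h3
  have hG : Fintype.card (ZMod n × ZMod n × ZMod n) = n * (n * n) := by
    simp only [Fintype.card_prod, ZMod.card]
  rw [hG] at hx
  refine arith (by omega) (x := (C u).card * (A u).card) ?_
  nlinarith [hx, hQ, h3]

/-- **No uniform third member (`n ≥ 5`).** An `IsSTPP` family in `(ℤ/n)³` with non-empty `C`-sets that contains the CKSU pair has no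
further member `u` with `|A_u| = |B_u| = n − 1`; in particular the pair does not extend to an STPP family of three
`(n−1, n−1, n−1)`-shaped triples.  (`(n−1)² > 3n − 2` iff `n ≥ 5`; at `n = 5`: `16 > 13`.) [original] -/
theorem no_uniform_third_member (hn : 5 ≤ n)
    (hP₀ : ∀ v, v ∈ P₀ ↔ v.1 ≠ 0 ∧ v.2.1 = 0 ∧ v.2.2 = 0)
    (hP₁ : ∀ v, v ∈ P₁ ↔ v.2.1 ≠ 0 ∧ v.1 = 0 ∧ v.2.2 = 0)
    (hP₂ : ∀ v, v ∈ P₂ ↔ v.2.2 ≠ 0 ∧ v.1 = 0 ∧ v.2.1 = 0)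
    (h : IsSTPP A B C) (hC : ∀ t, (C t).Nonempty) {j k u : Fin N} (hjk : j ≠ k) (huj : u ≠ j) (huk : u ≠ k)
    (hAj : A j = P₀) (hBj : B j = P₁) (hCj : C j = P₂) (hAk : A k = P₁) (hBk : B k = P₂) (hCk : C k = P₀) :
    ¬ ((A u).card = n - 1 ∧ (B u).card = n - 1) := by
  rintro ⟨ha, hb⟩
  have := card_mul_le (by omega) hP₀ hP₁ hP₂ h hC hjk huj huk hAj hBj hCj hAk hBk hCk
  rw [ha, hb] at this
  obtain ⟨m, rfl⟩ : ∃ m, n = m + 5 := ⟨n - 5, by omega⟩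
  simp only [show m + 5 - 1 = m + 4 by omega] at this
  nlinarith [this]

/-! ## One frame triple (the U14⁺ remark of `GroupTheoreticSTPPCThesisPackingSumset.lean`, formalised) -/

/-- The full room sumset of ONE punctured-axes triple: `(P₀ − P₁) + (P₂ − P₂) ⊇ {(x,y,z) : x ≠ 0, y ≠ 0}` (`n ≥ 3`),
so `|(P₀ − P₁) + (P₂ − P₂)| ≥ n(n−1)²`. [original] -/
theorem filter_subset_room (hn : 3 ≤ n)
    (hP₀ : ∀ v, v ∈ P₀ ↔ v.1 ≠ 0 ∧ v.2.1 = 0 ∧ v.2.2 = 0)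
    (hP₁ : ∀ v, v ∈ P₁ ↔ v.2.1 ≠ 0 ∧ v.1 = 0 ∧ v.2.2 = 0)
    (hP₂ : ∀ v, v ∈ P₂ ↔ v.2.2 ≠ 0 ∧ v.1 = 0 ∧ v.2.1 = 0) :
    (univ.filter fun x : ZMod n => x ≠ 0) ×ˢ ((univ.filter fun x : ZMod n => x ≠ 0) ×ˢ (univ : Finset (ZMod n)))
      ⊆ (P₀ - P₁) + (P₂ - P₂) := by
  intro v hv
  rw [mem_product, mem_product, mem_filter, mem_filter] at hv
  obtain ⟨⟨-, hx⟩, ⟨-, hy⟩, -⟩ := hv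
  obtain ⟨z₁, z₂, hz₁, hz₂, hz⟩ := exists_sub_of_ne_zero hn v.2.2
  rw [mem_add]
  refine ⟨(v.1, v.2.1, (0 : ZMod n)), ?_, ((0 : ZMod n), (0 : ZMod n), z₁ - z₂), ?_, ?_⟩
  · rw [mem_sub]
    refine ⟨(v.1, 0, 0), (hP₀ _).mpr ⟨hx, rfl, rfl⟩, (0, -v.2.1, 0), (hP₁ _).mpr ⟨neg_ne_zero.mpr hy, rfl, rfl⟩, ?_⟩
    exact Prod.ext (by simp) (Prod.ext (by simp) (by simp))
  · rw [mem_sub]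
    exact ⟨(0, 0, z₁), (hP₂ _).mpr ⟨hz₁, rfl, rfl⟩, (0, 0, z₂), (hP₂ _).mpr ⟨hz₂, rfl, rfl⟩,
      Prod.ext (by simp) (Prod.ext (by simp) rfl)⟩
  · exact Prod.ext (by simp) (Prod.ext (by simp) (by simpa using hz))

/-- **Through one frame triple** (the arithmetic remark of the tree's U14⁺ file, now a theorem): in `(ℤ/n)³`, `n ≥ 3`, an `IsSTPP`
family with non-empty `C`-sets containing the punctured-axes triple `(P₀, P₁, P₂)` at index `l` has
`Σ_{t ≠ l} |A_t||B_t| + n(n−1)² ≤ n³`, i.e. the other members' difference sets fit into `n³ − n(n−1)² = n(2n−1)` points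
(so at most two further `(n−1, n−1, ·)`-members when `n ≥ 6`, since `3(n−1)² > n(2n−1)` there). [original] -/
theorem sum_card_mul_le_of_frame (hn : 3 ≤ n)
    (hP₀ : ∀ v, v ∈ P₀ ↔ v.1 ≠ 0 ∧ v.2.1 = 0 ∧ v.2.2 = 0)
    (hP₁ : ∀ v, v ∈ P₁ ↔ v.2.1 ≠ 0 ∧ v.1 = 0 ∧ v.2.2 = 0)
    (hP₂ : ∀ v, v ∈ P₂ ↔ v.2.2 ≠ 0 ∧ v.1 = 0 ∧ v.2.1 = 0)
    (h : IsSTPP A B C) (hC : ∀ t, (C t).Nonempty) {l : Fin N} (hAl : A l = P₀) (hBl : B l = P₁) (hCl : C l = P₂) :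
    (∑ t ∈ univ.erase l, (A t).card * (B t).card) + n * ((n - 1) * (n - 1)) ≤ n * (n * n) := by
  classical
  have hx := STPPPackingSumset.sum_card_mul_add_card_sumset_le h hC l
  rw [hAl, hBl, hCl] at hx
  have hQ := card_le_card (filter_subset_room hn hP₀ hP₁ hP₂)
  rw [card_product, card_product, card_univ, ZMod.card, card_filter_ne_zero] at hQ
  have hG : Fintype.card (ZMod n × ZMod n × ZMod n) = n * (n * n) := by
    simp only [Fintype.card_prod, ZMod.card]
  rw [hG] at hx
  have e : (n - 1) * ((n - 1) * n) = n * ((n - 1) * (n - 1)) := by ring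
  omega

end STPPCKSUPair

end Summit.MatrixMultiplication.MatrixMultiplication.Theorems
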